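import Mathlib
import HarnessLib
import Summits.NavierStokesRegularity.NavierStokesRegularity.Theorems.TaylorModelRungThreeVRadiiDefs

/-!
# Line `taylor-model` on crux K1b-DR (stmt-NavierStokesRegularity-23954) — v3 NODE STEP: the level-0/level-1 node
# invariants and the derivative enclosure PROPAGATE across one sub-step (PROPAGATE-V-SPEC-cert1 rev. §1–§2 E;
# semantic half of `step_of_checkStepV`, successor engine-1 g67)

Pure consequence of the two v3 interface predicates and the flow package — no certificate tables, no arithmetic:

* `nodePair_step`: `ChainVCore cd bx`, `ChainVRadii cd bx rd`, `IsFlowPackageV cd bx φ`, `j ≤ N₀`, `s < S j` and a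
  level-1 node pair `NodePair cd bx rd j s ζ y₀ y` (centre point `y₀ = x_s + Cm_s ξ`, `|ξ| ≤ rPl 0`; polytope parameter
  `|ζ| ≤ rB`; `y − y₀ − Vc_s ζ` in the plain box `e_s`) give the pair one node later for the flow images
  `(φ(y₀)(h_s), φ(y)(h_s))`, with the SAME `ζ`. Proof = the Lohner split of the spec: by (F8′) (mean-value kernel
  `A₀ ∈ [M_s]` for the pair `(y₀, x_s)`, both in the outer hull by the hull clauses) and (F5′) at the centre (the jets
  `P j s n` ARE the Taylor jets of `x_s` by the a-block recursion, `eq_taylorJet_of_rec`),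
  `φ(y₀)(h) − x_{s+1} = A₀·(Cm ξ) + r` with `|r| ≤ |TP(h) − x_{s+1}| + J h^(p+1) ≤ ν` (R3), so
  `ξ' := Ci_{s+1}(A₀·(Cm ξ) + r)` has `|ξ'| ≤ rPl 0 (s+1)` by (R2) and `φ(y₀)(h) = x_{s+1} + Cm_{s+1} ξ'` by the exact
  frame clause a14 and window support (F0); and by (F8′) for the pair `(y, y₀)`,
  `φ(y)(h) − φ(y₀)(h) − Vc_{s+1} ζ = A₁·(Vc_s ζ + d) − Vc_{s+1} ζ`, bounded by `e_{s+1}` through (R4).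
* `kcomp` / `kapp_kcomp`: composition of window kernels; `derivEncl_step`: `DerivEncl … s L` and `A ∈ [M_s]` give
  `DerivEncl … (s+1) (kcomp A L)` through (R5) — the algebra of `Z_{s+1} := (CiBox·[M]·Cm)·Z_s + CiBox·Dm_s`; the
  analytic identification of `L` with the window derivative of the multi-step flow (chain rule on (F7′)) is the
  G-side's, exactly as for (F8′).

MODEL-lattice rung TL-M3 only; nothing here is a statement about the Navier–Stokes equations.
-/

noncomputable section

-- the sub-problem namespace repeats the summit name by design (D-0017)
set_option linter.dupNamespace false

namespace Summit.NavierStokesRegularity.NavierStokesRegularity.Theorems.TaylorModelV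

open scoped BigOperators
open Set Literature.Analysis.FluidPDE.TaoCascade Literature.Analysis.FluidPDE.TaoCascade.TaylorChain
open Summit.NavierStokesRegularity.NavierStokesRegularity.Theorems.TaylorModelReadout

variable {cd : CertData} {bx : StepBoxes} {rd : RadiiData}

/-! ### Window kernels: evaluation and composition -/

/-- `kapp` on a window row. [folklore] -/
theorem kapp_apply_of_InW (A : Ker) (v : Fin 4 → ℤ → ℝ) (i' : Fin 4) {k' : ℤ} (hk' : -cd.Kb ≤ k' ∧ k' ≤ cd.Ka) :
    kapp cd A v i' k' = ∑ c : Fin (nW cd), A i' k' (modeOf cd c) (shellOf cd c) * toVec cd v c := by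
  unfold kapp; rw [if_pos hk']

/-- `kapp` vanishes off the window rows. [folklore] -/
theorem kapp_off (A : Ker) (v : Fin 4 → ℤ → ℝ) (i' : Fin 4) {k' : ℤ} (hk' : ¬ (-cd.Kb ≤ k' ∧ k' ≤ cd.Ka)) :
    kapp cd A v i' k' = 0 := by
  unfold kapp; rw [if_neg hk']

/-- `kapp A v` is window-supported. [folklore] -/
theorem wsupp_kapp (A : Ker) (v : Fin 4 → ℤ → ℝ) : cd.Wsupp (kapp cd A v) := fun i' _ hk' => kapp_off A v i' hk'

/-- `kapp A` only reads the window values of its argument: states that agree on the window have the same image.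
[folklore] -/
theorem kapp_congr (A : Ker) {v w : Fin 4 → ℤ → ℝ} (h : ∀ i k, -cd.Kb ≤ k → k ≤ cd.Ka → v i k = w i k) :
    kapp cd A v = kapp cd A w := by
  funext i' k'
  by_cases hk' : -cd.Kb ≤ k' ∧ k' ≤ cd.Ka
  · rw [kapp_apply_of_InW A v i' hk', kapp_apply_of_InW A w i' hk']
    refine Finset.sum_congr rfl fun c _ => ?_
    have hc := shellOf_mem cd c
    simp only [toVec, h _ _ hc.1 hc.2]
  · rw [kapp_off A v i' hk', kapp_off A w i' hk']

/-- Composition of window kernels (matrix product through the semantic window enumeration). [folklore] -/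
def kcomp (cd : CertData) (A L : Ker) : Ker := fun i' k' i k =>
  ∑ c : Fin (nW cd), A i' k' (modeOf cd c) (shellOf cd c) * L (modeOf cd c) (shellOf cd c) i k

/-- `kapp (kcomp A L) v = kapp A (kapp L v)`. [folklore] -/
theorem kapp_kcomp (A L : Ker) (v : Fin 4 → ℤ → ℝ) : kapp cd (kcomp cd A L) v = kapp cd A (kapp cd L v) := by
  funext i' k'
  by_cases hk' : -cd.Kb ≤ k' ∧ k' ≤ cd.Ka
  · rw [kapp_apply_of_InW _ v i' hk', kapp_apply_of_InW A _ i' hk']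
    have e : ∀ c : Fin (nW cd), toVec cd (kapp cd L v) c =
        ∑ c' : Fin (nW cd), L (modeOf cd c) (shellOf cd c) (modeOf cd c') (shellOf cd c') * toVec cd v c' := fun c => by
      simp only [toVec]
      exact kapp_apply_of_InW L v (modeOf cd c) (shellOf_mem cd c)
    simp only [kcomp, e, Finset.sum_mul, Finset.mul_sum]
    rw [Finset.sum_comm]
    exact Finset.sum_congr rfl fun c _ => Finset.sum_congr rfl fun c' _ => by ring
  · rw [kapp_off _ v i' hk', kapp_off A _ i' hk']

/-! ### The node step -/

section Step

variable {φ : Flow} {j s : ℕ}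

/-- `InBox` is monotone in the box (hull nesting). [folklore] -/
theorem inBox_mono {lo hi lo' hi' y : Fin 4 → ℤ → ℝ}
    (hle : ∀ i k, lo' i k ≤ lo i k ∧ hi i k ≤ hi' i k) (h : InBox cd lo hi y) : InBox cd lo' hi' y :=
  fun i k hk1 hk2 => ⟨(hle i k).1.trans (h i k hk1 hk2).1, (h i k hk1 hk2).2.trans (hle i k).2⟩

/-- The certificate's jets at a node ARE the Taylor jets of its centre (a-block recursion + uniqueness). [folklore] -/
theorem P_eq_taylorJet (hP0 : cd.P j s 0 = cd.x j s)
    (hPrec : ∀ n, n < cd.pdeg → ∀ i k, ((n : ℝ) + 1) * cd.P j s (n + 1) i k =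
      ∑ m' ∈ Finset.range (n + 1), cd.Qb (cd.P j s m') (cd.P j s (n - m')) i k) :
    ∀ n, n ≤ cd.pdeg → cd.P j s n = taylorJet cd.Qb (cd.x j s) n :=
  eq_taylorJet_of_rec cd.Qb (cd.x j s) hP0 fun n hn => by
    funext i k
    simp only [Pi.smul_apply, smul_eq_mul, Finset.sum_apply]
    exact hPrec n hn i k

/-- **THE NODE STEP (levels 0 and 1).** [folklore; cite Zgliczynski2002C1Lohner §3–4; Lohner 1988 §2] -/
theorem nodePair_step (hC : ChainVCore cd bx) (hR : ChainVRadii cd bx rd) (hF : IsFlowPackageV cd bx φ)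
    (hj : j ≤ cd.N₀) (hs : s < cd.S j) {ζ y₀ y : Fin 4 → ℤ → ℝ} (hN : NodePair cd bx rd j s ζ y₀ y) :
    NodePair cd bx rd j (s + 1) ζ (stAt φ j y₀ (cd.h j s)) (stAt φ j y (cd.h j s)) := by
  -- unpack the interface
  obtain ⟨-, -, hA, -⟩ := hC j hj
  obtain ⟨hwsx, hwsP, hlinCm, -, hfr, hP0, hPrec, -, -, -, hrP0, -, hhull, hnest⟩ := hA s hs.le
  obtain ⟨-, -, hlinCm', -, hfr', -⟩ := hA (s + 1) hs
  obtain ⟨-, -, -, -, -, -, hRn, hRs⟩ := hR j hj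
  obtain ⟨-, -, -, hhinge⟩ := hRn s hs.le
  obtain ⟨hR3, hR2, hR4, -⟩ := hRs s hs
  obtain ⟨-, hFj⟩ := hF
  obtain ⟨hF0, -, hFs⟩ := hFj j hj
  obtain ⟨-, -, -, hF5, -, hF8⟩ := hFs s hs
  obtain ⟨⟨ξ, hξ, hy₀⟩, hζ, hd⟩ := hN
  set h := cd.h j s with hh
  have hhI : h ∈ Icc 0 (cd.h j s) := ⟨(hC j hj).2.2.2 s hs |>.1.le, le_rfl⟩
  -- hulls: `x_s`, `y₀` ∈ hull 0 ⊆ hull 2, `y` ∈ hull 1 ⊆ hull 2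
  have hx0 : NodeStart cd bx j s 0 (cd.x j s) :=
    ⟨0, fun i k _ _ => by simpa using hrP0 0 i k, by rw [hlinCm.map_zero, add_zero]⟩
  have hxH : InBox cd (bx.hlo 2 j s) (bx.hhi 2 j s) (cd.x j s) := inBox_mono (hnest 0) (hhull 0 _ hx0)
  have hy₀H : InBox cd (bx.hlo 2 j s) (bx.hhi 2 j s) y₀ := inBox_mono (hnest 0) (hhull 0 _ ⟨ξ, hξ, hy₀⟩)
  have hyH : InBox cd (bx.hlo 2 j s) (bx.hhi 2 j s) y :=
    inBox_mono (hnest 1) (hhinge ζ y₀ y ⟨⟨ξ, hξ, hy₀⟩, hζ, hd⟩)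
  -- (F8′) for the pairs `(y₀, x_s)` and `(y, y₀)`
  obtain ⟨A₀, hA₀, hE₀⟩ := hF8 y₀ (cd.x j s) hy₀H hxH
  obtain ⟨A₁, hA₁, hE₁⟩ := hF8 y y₀ hyH hy₀H
  -- the centre remainder `r := φ(x_s)(h) − x_{s+1}`
  set r : Fin 4 → ℤ → ℝ := stAt φ j (cd.x j s) h - cd.x j (s + 1) with hr
  have hPj := P_eq_taylorJet hP0 hPrec
  have hrν : AbsLeW cd r (rd.ν j s) := by
    intro i k hk1 hk2
    have h5 := hF5 (cd.x j s) hxH h hhI i k hk1 hk2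
    have hTP : ∑ n ∈ Finset.range (cd.pdeg + 1), taylorJet cd.Qb (cd.x j s) n i k * h ^ n = cd.TP j s h i k := by
      simp only [CertData.TP]
      exact Finset.sum_congr rfl fun n hn => by rw [← hPj n (Nat.lt_succ_iff.1 (Finset.mem_range.1 hn))]
    rw [hTP] at h5
    have h3 := hR3 i k hk1 hk2
    have e : r i k = (stAt φ j (cd.x j s) h i k - cd.TP j s h i k) + (cd.TP j s h i k - cd.x j (s + 1) i k) := by
      simp only [hr, Pi.sub_apply]; ring
    rw [e]
    exact (abs_add_le _ _).trans (by linarith)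
  -- the new frame coordinates
  set w : Fin 4 → ℤ → ℝ := kapp cd A₀ (cd.Cm j s ξ) + r with hw
  have hws_w : cd.Wsupp w := by
    intro i k hk
    have : r i k = 0 := by
      simp only [hr, Pi.sub_apply, stAt, hF0 _ i k hk, (hA (s + 1) hs).1 i k hk, sub_zero]
    simp only [hw, Pi.add_apply, kapp_off A₀ _ i hk, this, add_zero]
  have hξ' : AbsLeW cd (cd.Ci j (s + 1) w) (bx.rPl 0 j (s + 1)) := hR2 A₀ hA₀ ξ r hξ hrν
  have hnode : stAt φ j y₀ h = cd.x j (s + 1) + cd.Cm j (s + 1) (cd.Ci j (s + 1) w) := by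
    rw [((hfr' w).2.2 hws_w).2]
    funext i k
    by_cases hk : -cd.Kb ≤ k ∧ k ≤ cd.Ka
    · have e0 := hE₀ i k hk.1 hk.2
      rw [hy₀] at e0 ⊢
      rw [add_sub_cancel_left] at e0
      simp only [hw, Pi.add_apply, kapp_apply_of_InW A₀ _ i hk, hr, Pi.sub_apply]
      rw [← e0]
      simp only [Pi.sub_apply]
      ring
    · simp only [Pi.add_apply, stAt, hF0 _ i k hk, (hA (s + 1) hs).1 i k hk, hws_w i k hk, add_zero]
  refine ⟨⟨cd.Ci j (s + 1) w, hξ', hnode⟩, hζ, ?_⟩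
  -- level 1: `φ(y)(h) − φ(y₀)(h) − Vc' ζ = A₁·(Vc ζ + d) − Vc' ζ`
  have hd' := hR4 A₁ hA₁ ζ (y - y₀ - rd.Vc j s ζ) hζ hd
  have hsum : rd.Vc j s ζ + (y - y₀ - rd.Vc j s ζ) = y - y₀ := by abel
  rw [hsum] at hd'
  intro i k hk1 hk2
  have e1 := hE₁ i k hk1 hk2
  rw [← kapp_apply_of_InW A₁ (y - y₀) i ⟨hk1, hk2⟩] at e1
  have := hd' i k hk1 hk2
  simp only [Pi.sub_apply] at this e1 ⊢
  rw [e1]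
  exact this

/-- **Derivative-error transport**: `DerivEncl` propagates under left composition with any kernel of `[M_s]`.
[folklore; cite Zgliczynski2002C1Lohner §4] -/
theorem derivEncl_step (hR : ChainVRadii cd bx rd) (hj : j ≤ cd.N₀) (hs : s < cd.S j) {A : Ker}
    (hA : KerMem cd A (bx.Mlo j s) (bx.Mhi j s)) {L : Ker} (hL : DerivEncl cd rd j s L) :
    DerivEncl cd rd j (s + 1) (kcomp cd A L) := by
  obtain ⟨-, -, -, -, -, -, -, hRs⟩ := hR j hj
  obtain ⟨-, -, -, hR5⟩ := hRs s hs
  obtain ⟨W, hW, hLW⟩ := hL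
  obtain ⟨W', hW', hE⟩ := hR5 A hA W hW
  refine ⟨W', hW', fun v hv => ?_⟩
  rw [kapp_kcomp, hLW v hv]
  exact hE v hv

end Step

end Summit.NavierStokesRegularity.NavierStokesRegularity.Theorems.TaylorModelV

end
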